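import Summits.QuantumFields.YangMills.Theorems.UnitScaleTiltProp7CovCombGauss
import Summits.QuantumFields.YangMills.Theorems.UnitScaleTiltProp7LineAvgSmoothNormal
import Summits.QuantumFields.YangMills.Theorems.UnitScaleTiltProp7CovRightInverse
import Summits.QuantumFields.YangMills.Theorems.UnitScaleTiltProp7OptimalSlice
import HarnessLib

/-!
# Route `UnitScaleTilt`, crux K1 «MinimiserStabilityRegPr» (stmt-QuantumFields-19200), route-R E′ S3 K-form engine, row R3′ ∕ (P) — «BLOCK-GAUSS»:
# the covariant Gauss law ✓ `Prop7CovCombGauss.sum_R_divB_eq` READ AT A `k`-BLOCK `B(y)` IN BLOCK-OFFSET LETTERS — sites `x_r = Site.fibreSite 0 k y r`,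
# `r : Fin d → Fin L^k`, an ARBITRARY transport assignment `T_r` indexed by the offsets (the comb of record is one choice), the far layer `{r_μ = L^k − 1}` = outflow,
# the near layer `{r_μ = 0}` = inflow, the interior bonds `(x_r, x_r + e_μ)`, `r_μ + 1 < L^k`, with their loop holonomies `h = T_r⁻¹·T_{r+e_μ}·U_μ(x_r)⁻¹` — exact, any ring

Cell `ym3-torus`, width seat `ym3-torus-px15` (gen 3); «BLOCK-GAUSS» (★ym-ust-19200-p1 g16 SIGN-IN word (2): «R5 consumes ✓p669014 in `k`-BLOCK letters (far∕near layers in `fibreSite`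
offsets), not generic `S`»; pen of record ym3-torus-px17 g2, typed by this seat under the conditional claim of 2026-08-28T23:54Z).  THEOREMS ONLY (0 `def`, 0 `sorry`, 0 `instance`);
`--supports stmt-QuantumFields-19200`, count-neutral.  YM₃ on T³ is a ladder rung (R3), not the Clay problem; nothing here claims a stub, the crux, d = 4 or the mass gap.

THE POINT.  ✓p669014 states Gauss' law for ANY finite site set `S` with membership filters `{x ∈ S : x ∓ e_μ ∈∕∉ S}`.  The R3′ inhabitant (px17 LOCATE-R3PRIME-COVFACEFLUX §3 (G1)–(G4)) and
the (P) knit read it at `S = B(y)`: then the three filters ARE the block's layers, and everything is a sum over offsets `r` — the currency of the engine's line∕face functionals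
(✓p669695 `Prop7CovFaceFluxLineStep`, ✓ `Prop7CovRightInverse`: `Site.fibreSite 0 k c.src r`, `Function.update r μ s`).  This file does exactly that bookkeeping, once, for an arbitrary
offset-indexed transport `T` and an arbitrary unit-valued background `U` (`B9Eq39Adjoint` letters `R`, `divB` on `torusT P 0`; `R = conjR` by `rfl`).

WHAT IS PROVED (ns `…Theorems.Prop7CovBlockGauss`; any `P`, level `k` with `sitesPerDir 0 = L^k·sitesPerDir k`, any ring `𝔸`).
* §1 block-offset geometry (the torus has ≥ 2 sites per direction: ✓ `Prop7OptimalSlice.unshift_ne_self`): `fibreSite_injective`, `fibreEquiv_fibreSite`, `fibreSite_unshift_of_pos` (a step back INSIDE the block),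
  `fibreSite_unshift_of_zero` (a step back ACROSS the near face lands in the far layer of `B(y − e_μ)`), and the three LAYER READINGS of ✓p669014's filters:
  `fibreSite_unshift_mem_iff` (`x_r − e_μ ∈ B(y) ↔ 1 ≤ r_μ`), `fibreSite_shift_not_mem_iff` (`x_r + e_μ ∉ B(y) ↔ r_μ + 1 = L^k`), `fibreSite_unshift_not_mem_iff` (`↔ r_μ = 0`).
* §2 ★★ `block_sum_R_divB_eq` — `Σ_r R(T_r)(D*_UB)(x_r) = INT + IN − OUT` with
  `INT = Σ_μ Σ_{r : r_μ+1 < L^k} R(T_r)(R(T_r⁻¹·T_{r+e_μ}·U_μ(x_r)⁻¹)B_μ(x_r) − B_μ(x_r))` (interior bonds by their SOURCE offset — px17's `h_b = comb_x⁻¹·comb_{x+e_μ}·W_b⁻¹`),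
  `IN = Σ_μ Σ_{r : r_μ = 0} R(T_r·U_μ(x_r − e_μ)⁻¹)B_μ(x_r − e_μ)`, `OUT = Σ_μ Σ_{r : r_μ+1 = L^k} R(T_r)B_μ(x_r)`;
  ★★ `block_outflow_eq_of_divB_eq_zero` — for `D*_UB = 0` on `B(y)`: `OUT = IN + INT`; ★ `block_inflow_eq_far_layer` — `IN` re-indexed on the far layer of `B(y − e_μ)` (the
  near face of `B(y)` is the far face of `B(y − e_μ)`; the bond meeting the coarse pairing ✓ `Prop7CovFaceFluxPairing.sum_re_trace_pureGauge_mul_eq`'s `⟨y − e_μ, μ⟩` summand).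
* §3 ★ `sum_eq_sum_far_layer_lines` — line-mates regrouping `Σ_r g r = Σ_{r̄ far} Σ_{s < L^k} g (r̄ with r̄_μ ↦ s)` (behind `FACE′_c = L^k • OUT_μ(y)`).
* §4 (v1.1) ★★ `block_netFlux_eq_int_add_junction` — per-block transports `T_y`, coarse bond units `V_μ(y′)`, co-closed `B`: the coarse NET FLUX
  `Σ_μ (OUT_μ(y) − R(V_μ(y−e_μ)⁻¹)OUT_μ(y−e_μ))` equals `Σ_μ INT_μ(y)` plus the near-face JUNCTION `J_VH` (transport mismatch, bond by bond on the far layer of `B(y − e_μ)`), exactly.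
HONEST SCOPE.  Finite bookkeeping over ✓p669014 (one `Finset.sum_image` per filter, one re-indexing `r ↦ r + e_μ` of the interior bonds); no estimate, no comb, no smallness; the Stokes
bound of `h − 1`, the line-mates regrouping of `OUT` into the face functional and the junction `J_VH` at the near face are the (P)-inhabitant's next bricks.

References: T. Bałaban, CMP 99 (1985) 389–434 [Balaban1985BackgroundPropagators] ((3.5) p.391, (3.8) p.392); CMP 95 (1984) 17–40 [Balaban1984PropagatorsI] ((1.21) p.21);
CMP 109 (1987) 249–301 [Balaban1987RG1] ((0.1)–(0.3) pp.251–252, blocks); CMP 102 (1985) 277–309 [Balaban1985Variational] (Prop. 7 p.299).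
-/

set_option autoImplicit false

noncomputable section

open scoped BigOperators

namespace Summit.QuantumFields.YangMills.Theorems.Prop7CovBlockGauss

open Literature.MathematicalPhysics.QuantumFieldTheory.Balaban1983to89
open Finset
open B9Eq39Adjoint (R R_one R_mul divB)
open B9TorusCalculus (torusT)
open B10StarCount (shift_unshift unshift_shift shift_apply_ne shift_apply_self)
open Summit.QuantumFields.YangMills.Theorems.Prop7CovCombGauss (sum_R_divB_eq)
open Summit.QuantumFields.YangMills.Theorems.Prop7OptimalSlice (unshift_ne_self)
open Summit.QuantumFields.YangMills.Theorems.Prop7LineAvgSmoothRightInverse (fibreSite_shift_of_lt fibreSite_shift_of_eq)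

variable {P : Params} {k : ℕ}

/-! ## §1 Block-offset geometry: steps, injectivity, the three layers -/

section Geometry

/-- The block offsets parametrise `B(y)` injectively (✓ `Site.fibreEquiv`). [cite: Balaban1987RG1, (0.3) p.252] -/
theorem fibreSite_injective (h : P.sitesPerDir 0 = P.L ^ k * P.sitesPerDir k) (y : Site P k) :
    Function.Injective (Site.fibreSite (P := P) 0 k y) := by
  intro r r' hrr
  have e1 : (Site.fibreEquiv h y).symm r = (Site.fibreEquiv h y).symm r' := Subtype.ext hrr
  exact (Site.fibreEquiv h y).symm.injective e1

/-- The offset read back by `Site.fibreEquiv`: `fibreEquiv ⟨x_r, _⟩ = r`. [cite: Balaban1987RG1, (0.3) p.252] -/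
theorem fibreEquiv_fibreSite (h : P.sitesPerDir 0 = P.L ^ k * P.sitesPerDir k) (y : Site P k) (r : Fin P.d → Fin (P.L ^ k))
    (hx : Site.proj k k (Site.fibreSite 0 k y r) = y) :
    Site.fibreEquiv h y ⟨Site.fibreSite 0 k y r, hx⟩ = r := by
  have e : (⟨Site.fibreSite 0 k y r, hx⟩ : {x : Site P 0 // Site.proj k k x = y}) = (Site.fibreEquiv h y).symm r := Subtype.ext rfl
  rw [e, Equiv.apply_symm_apply]

/-- Offset bookkeeping: re-setting the `μ`-entry of an updated offset to its old value gives the offset back. [folklore] -/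
theorem update_update_eq_self {n : ℕ} (r : Fin P.d → Fin n) (μ : Fin P.d) (a b : Fin n) (hb : (b : ℕ) = (r μ : ℕ)) :
    Function.update (Function.update r μ a) μ b = r := by
  rw [Function.update_idem, Fin.ext hb, Function.update_eq_self]

/-- A step back INSIDE the block (`1 ≤ r_μ`): same block, the `μ`-offset decreases by one. [cite: Balaban1987RG1, (0.3) p.252] -/
theorem fibreSite_unshift_of_pos (y : Site P k) (r : Fin P.d → Fin (P.L ^ k)) (μ : Fin P.d) (hr : 1 ≤ (r μ : ℕ)) :
    (Site.fibreSite 0 k y r).unshift μ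
      = Site.fibreSite 0 k y (Function.update r μ ⟨(r μ : ℕ) - 1, lt_of_le_of_lt (Nat.sub_le _ _) (r μ).isLt⟩) := by
  set r' : Fin P.d → Fin (P.L ^ k) := Function.update r μ ⟨(r μ : ℕ) - 1, lt_of_le_of_lt (Nat.sub_le _ _) (r μ).isLt⟩ with hr'
  have hr'μ : (r' μ : ℕ) = (r μ : ℕ) - 1 := by simp [hr']
  have hlt : (r' μ : ℕ) + 1 < P.L ^ k := by
    rw [hr'μ]
    have := (r μ).isLt
    omega
  have hs := fibreSite_shift_of_lt y r' μ hlt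
  have hupd : Function.update r' μ ⟨(r' μ : ℕ) + 1, hlt⟩ = r :=
    update_update_eq_self r μ _ _ (by simp only [hr'μ]; omega)
  rw [hupd] at hs
  rw [← hs, unshift_shift]

/-- A step back ACROSS the near face (`r_μ = 0`): the block recedes by `e_μ`, the `μ`-offset becomes `L^k − 1` (the far layer of `B(y − e_μ)`). [cite: Balaban1987RG1, (0.3) p.252] -/
theorem fibreSite_unshift_of_zero (h : P.sitesPerDir 0 = P.L ^ k * P.sitesPerDir k) (y : Site P k) (r : Fin P.d → Fin (P.L ^ k)) (μ : Fin P.d)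
    (hr : (r μ : ℕ) = 0) :
    (Site.fibreSite 0 k y r).unshift μ
      = Site.fibreSite 0 k (y.unshift μ) (Function.update r μ ⟨P.L ^ k - 1, Nat.sub_lt (pow_pos P.L_pos k) one_pos⟩) := by
  set r' : Fin P.d → Fin (P.L ^ k) := Function.update r μ ⟨P.L ^ k - 1, Nat.sub_lt (pow_pos P.L_pos k) one_pos⟩ with hr'
  have hr'μ : (r' μ : ℕ) + 1 = P.L ^ k := by
    have : 0 < P.L ^ k := pow_pos P.L_pos k
    simp [hr']
    omega
  have hs := fibreSite_shift_of_eq h (y.unshift μ) r' μ hr'μ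
  rw [shift_unshift] at hs
  have hupd : Function.update r' μ ⟨0, pow_pos P.L_pos k⟩ = r := update_update_eq_self r μ _ _ (by simp only [hr])
  rw [hupd] at hs
  rw [← hs, unshift_shift]

/-- NEAR∕INTERIOR LAYER READING of ✓p669014's inflow∕interior filter: `x_r − e_μ ∈ B(y) ↔ 1 ≤ r_μ`. [cite: Balaban1987RG1, (0.3) p.252] -/
theorem fibreSite_unshift_mem_iff (h : P.sitesPerDir 0 = P.L ^ k * P.sitesPerDir k) (y : Site P k) (r : Fin P.d → Fin (P.L ^ k)) (μ : Fin P.d) :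
    (Site.fibreSite 0 k y r).unshift μ ∈ univ.image (Site.fibreSite (P := P) 0 k y) ↔ 1 ≤ (r μ : ℕ) := by
  constructor
  · intro hmem
    by_contra hlt
    have hr0 : (r μ : ℕ) = 0 := by omega
    rw [fibreSite_unshift_of_zero h y r μ hr0] at hmem
    obtain ⟨r₀, -, hr₀⟩ := mem_image.mp hmem
    have h1 := congrArg (Site.proj k k) hr₀
    rw [Site.proj_fibreSite h, Site.proj_fibreSite h] at h1
    exact unshift_ne_self y μ h1.symm
  · intro hr
    rw [fibreSite_unshift_of_pos y r μ hr]
    exact mem_image_of_mem _ (mem_univ _)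

/-- NEAR LAYER: `x_r − e_μ ∉ B(y) ↔ r_μ = 0`. [cite: Balaban1987RG1, (0.3) p.252] -/
theorem fibreSite_unshift_not_mem_iff (h : P.sitesPerDir 0 = P.L ^ k * P.sitesPerDir k) (y : Site P k) (r : Fin P.d → Fin (P.L ^ k)) (μ : Fin P.d) :
    (Site.fibreSite 0 k y r).unshift μ ∉ univ.image (Site.fibreSite (P := P) 0 k y) ↔ (r μ : ℕ) = 0 := by
  rw [fibreSite_unshift_mem_iff h]
  omega

/-- FAR LAYER READING of ✓p669014's outflow filter: `x_r + e_μ ∉ B(y) ↔ r_μ + 1 = L^k`. [cite: Balaban1987RG1, (0.3) p.252] -/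
theorem fibreSite_shift_not_mem_iff (h : P.sitesPerDir 0 = P.L ^ k * P.sitesPerDir k) (y : Site P k) (r : Fin P.d → Fin (P.L ^ k)) (μ : Fin P.d) :
    (Site.fibreSite 0 k y r).shift μ ∉ univ.image (Site.fibreSite (P := P) 0 k y) ↔ (r μ : ℕ) + 1 = P.L ^ k := by
  constructor
  · intro hnot
    by_contra hne
    have hlt : (r μ : ℕ) + 1 < P.L ^ k := by have := (r μ).isLt; omega
    apply hnot
    rw [fibreSite_shift_of_lt y r μ hlt]
    exact mem_image_of_mem _ (mem_univ _)
  · intro hr hmem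
    rw [fibreSite_shift_of_eq h y r μ hr] at hmem
    obtain ⟨r₀, -, hr₀⟩ := mem_image.mp hmem
    have h1 := congrArg (fun z => (Site.proj k k z).unshift μ) hr₀
    simp only [Site.proj_fibreSite h, unshift_shift] at h1
    exact unshift_ne_self y μ h1

end Geometry

/-! ## §2 The covariant Gauss law of a block in offset letters -/

section Gauss

variable {𝔸 : Type*} [Ring 𝔸]

/-- Sums over a filtered block, read in offsets: `Σ_{x ∈ B(y), p x} f x = Σ_{r : p x_r} f x_r`. [cite: Balaban1987RG1, (0.3) p.252] -/
theorem sum_filter_image_fibreSite (h : P.sitesPerDir 0 = P.L ^ k * P.sitesPerDir k) (y : Site P k)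
    (p : Site P 0 → Prop) [DecidablePred p] {M : Type*} [AddCommMonoid M] (f : Site P 0 → M) :
    ∑ x ∈ (univ.image (Site.fibreSite (P := P) 0 k y)).filter p, f x
      = ∑ r ∈ univ.filter (fun r : Fin P.d → Fin (P.L ^ k) => p (Site.fibreSite 0 k y r)), f (Site.fibreSite 0 k y r) := by
  rw [Finset.filter_image, Finset.sum_image]
  exact fun r _ r' _ hrr => fibreSite_injective h y hrr

/-- ★★ **THE COVARIANT GAUSS LAW OF A BLOCK, IN OFFSET LETTERS.**  For the `k`-block `B(y) = {x_r = fibreSite 0 k y r}`, ANY offset-indexed transports `T_r`, any unit-valued background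
`U` and bond field `B`:
`Σ_r R(T_r)(D*_UB)(x_r) = Σ_μ Σ_{r_μ+1<L^k} R(T_r)(R(T_r⁻¹·T_{r+e_μ}·U_μ(x_r)⁻¹)B_μ(x_r) − B_μ(x_r)) + Σ_μ Σ_{r_μ=0} R(T_r·U_μ(x_r−e_μ)⁻¹)B_μ(x_r−e_μ) − Σ_μ Σ_{r_μ+1=L^k} R(T_r)B_μ(x_r)`
— interior holonomy defect (bonds `(x_r, x_r+e_μ) ⊂ B(y)` by their source) + inflow through the near layer − outflow through the far layer; exact.
[cite: Balaban1985BackgroundPropagators, (3.8) p.392, (3.5) p.391; Balaban1984PropagatorsI, (1.21) p.21; Balaban1987RG1, (0.3) p.252] -/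
theorem block_sum_R_divB_eq (h : P.sitesPerDir 0 = P.L ^ k * P.sitesPerDir k) (y : Site P k)
    (T : (Fin P.d → Fin (P.L ^ k)) → 𝔸ˣ) (U : Fin P.d → Site P 0 → 𝔸ˣ) (B : Fin P.d → Site P 0 → 𝔸) :
    ∑ r : Fin P.d → Fin (P.L ^ k), R (T r) (divB (torusT P 0) U B (Site.fibreSite 0 k y r))
      = ∑ μ : Fin P.d, ∑ r ∈ univ.filter (fun r : Fin P.d → Fin (P.L ^ k) => (r μ : ℕ) + 1 < P.L ^ k),
            R (T r) (R ((T r)⁻¹ * T (Function.update r μ ⟨min ((r μ : ℕ) + 1) (P.L ^ k - 1), by have := (r μ).isLt; omega⟩) * (U μ (Site.fibreSite 0 k y r))⁻¹)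
              (B μ (Site.fibreSite 0 k y r)) - B μ (Site.fibreSite 0 k y r))
        + ∑ μ : Fin P.d, ∑ r ∈ univ.filter (fun r : Fin P.d → Fin (P.L ^ k) => (r μ : ℕ) = 0),
            R (T r * (U μ ((Site.fibreSite 0 k y r).unshift μ))⁻¹) (B μ ((Site.fibreSite 0 k y r).unshift μ))
        - ∑ μ : Fin P.d, ∑ r ∈ univ.filter (fun r : Fin P.d → Fin (P.L ^ k) => (r μ : ℕ) + 1 = P.L ^ k),
            R (T r) (B μ (Site.fibreSite 0 k y r)) := by
  classical
  -- the transport assignment on the torus: `T` read through the offset of `x ∈ B(y)`, `1` elsewhere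
  let Tx : Site P 0 → 𝔸ˣ := fun x => if hx : Site.proj k k x = y then T (Site.fibreEquiv h y ⟨x, hx⟩) else 1
  have hTx : ∀ r, Tx (Site.fibreSite 0 k y r) = T r := fun r => by
    simp only [Tx, dif_pos (Site.proj_fibreSite h y r), fibreEquiv_fibreSite h y r (Site.proj_fibreSite h y r)]
  set S : Finset (Site P 0) := univ.image (Site.fibreSite (P := P) 0 k y) with hS
  have hG := sum_R_divB_eq S Tx U B
  -- left side in offsets
  have hL : ∑ x ∈ S, R (Tx x) (divB (torusT P 0) U B x) = ∑ r : Fin P.d → Fin (P.L ^ k), R (T r) (divB (torusT P 0) U B (Site.fibreSite 0 k y r)) := by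
    rw [hS, Finset.sum_image (fun r _ r' _ hrr => fibreSite_injective h y hrr)]
    exact Finset.sum_congr rfl fun r _ => by rw [hTx]
  -- the outflow in offsets
  have hOUT : ∀ μ : Fin P.d, ∑ x ∈ S.filter (fun x => x.shift μ ∉ S), R (Tx x) (B μ x)
      = ∑ r ∈ univ.filter (fun r : Fin P.d → Fin (P.L ^ k) => (r μ : ℕ) + 1 = P.L ^ k), R (T r) (B μ (Site.fibreSite 0 k y r)) := by
    intro μ
    rw [hS, sum_filter_image_fibreSite h y]
    rw [Finset.filter_congr (fun r _ => fibreSite_shift_not_mem_iff h y r μ)]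
    exact Finset.sum_congr rfl fun r _ => by rw [hTx]
  -- the inflow in offsets
  have hIN : ∀ μ : Fin P.d, ∑ x ∈ S.filter (fun x => x.unshift μ ∉ S), R (Tx x * (U μ (x.unshift μ))⁻¹) (B μ (x.unshift μ))
      = ∑ r ∈ univ.filter (fun r : Fin P.d → Fin (P.L ^ k) => (r μ : ℕ) = 0),
          R (T r * (U μ ((Site.fibreSite 0 k y r).unshift μ))⁻¹) (B μ ((Site.fibreSite 0 k y r).unshift μ)) := by
    intro μ
    rw [hS, sum_filter_image_fibreSite h y]
    rw [Finset.filter_congr (fun r _ => fibreSite_unshift_not_mem_iff h y r μ)]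
    exact Finset.sum_congr rfl fun r _ => by rw [hTx]
  -- the interior in offsets, indexed by the bond's ENDPOINT offset `r` (`1 ≤ r_μ`), then re-indexed by its SOURCE `r − e_μ`
  have hINT : ∀ μ : Fin P.d, ∑ x ∈ S.filter (fun x => x.unshift μ ∈ S),
        R (Tx (x.unshift μ)) (R ((Tx (x.unshift μ))⁻¹ * Tx x * (U μ (x.unshift μ))⁻¹) (B μ (x.unshift μ)) - B μ (x.unshift μ))
      = ∑ r ∈ univ.filter (fun r : Fin P.d → Fin (P.L ^ k) => (r μ : ℕ) + 1 < P.L ^ k),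
          R (T r) (R ((T r)⁻¹ * T (Function.update r μ ⟨min ((r μ : ℕ) + 1) (P.L ^ k - 1), by have := (r μ).isLt; omega⟩) * (U μ (Site.fibreSite 0 k y r))⁻¹)
            (B μ (Site.fibreSite 0 k y r)) - B μ (Site.fibreSite 0 k y r)) := by
    intro μ
    rw [hS, sum_filter_image_fibreSite h y]
    rw [Finset.filter_congr (fun r _ => fibreSite_unshift_mem_iff h y r μ)]
    -- re-index: endpoint offset `r` (`1 ≤ r_μ`) ↦ source offset `r − e_μ` (`(r − e_μ)_μ + 1 < L^k`)
    symm
    refine Finset.sum_nbij' (fun r => Function.update r μ ⟨min ((r μ : ℕ) + 1) (P.L ^ k - 1), by have := (r μ).isLt; omega⟩)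
      (fun r => Function.update r μ ⟨(r μ : ℕ) - 1, lt_of_le_of_lt (Nat.sub_le _ _) (r μ).isLt⟩) ?_ ?_ ?_ ?_ ?_
    · intro r hr
      simp only [Finset.mem_filter, Finset.mem_univ, true_and] at hr ⊢
      simp only [Function.update_self, Fin.val_mk]
      omega
    · intro r hr
      simp only [Finset.mem_filter, Finset.mem_univ, true_and] at hr ⊢
      simp only [Function.update_self, Fin.val_mk]
      have := (r μ).isLt
      omega
    · intro r hr
      simp only [Finset.mem_filter, Finset.mem_univ, true_and] at hr
      exact update_update_eq_self r μ _ _ (by simp only [Function.update_self, Fin.val_mk]; omega)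
    · intro r hr
      simp only [Finset.mem_filter, Finset.mem_univ, true_and] at hr
      exact update_update_eq_self r μ _ _ (by simp only [Function.update_self, Fin.val_mk]; have := (r μ).isLt; omega)
    · intro r hr
      simp only [Finset.mem_filter, Finset.mem_univ, true_and] at hr
      -- the endpoint `x_{r+e_μ}` steps back to `x_r`
      set r' : Fin P.d → Fin (P.L ^ k) := Function.update r μ ⟨min ((r μ : ℕ) + 1) (P.L ^ k - 1), by have := (r μ).isLt; omega⟩ with hr'
      have hr'μ : (r' μ : ℕ) = (r μ : ℕ) + 1 := by
        simp only [hr', Function.update_self, Fin.val_mk]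
        omega
      have hpos : 1 ≤ (r' μ : ℕ) := by omega
      have hback : Function.update r' μ ⟨(r' μ : ℕ) - 1, lt_of_le_of_lt (Nat.sub_le _ _) (r' μ).isLt⟩ = r :=
        update_update_eq_self r μ _ _ (by simp only [hr'μ]; omega)
      have hun : (Site.fibreSite 0 k y r').unshift μ = Site.fibreSite 0 k y r := by
        rw [fibreSite_unshift_of_pos y r' μ hpos, hback]
      rw [hun, hTx, hTx]
  -- assemble
  rw [hL] at hG
  rw [hG]
  congr 1
  · congr 1
    · exact Finset.sum_congr rfl fun μ _ => hINT μ
    · exact Finset.sum_congr rfl fun μ _ => hIN μ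
  · exact Finset.sum_congr rfl fun μ _ => hOUT μ

/-- ★★ **GAUSS' LAW OF A BLOCK FOR A COVARIANTLY CO-CLOSED FIELD**: if `(D*_UB)(x) = 0` on `B(y)`, the outflow through the far layers equals the inflow through the near layers plus the
interior holonomy defect (all in offset letters, transports `T_r` arbitrary).  Flat (`T ≡ 1`, `U ≡ 1`): the net flux of a block vanishes — ✓ `Prop7FaceFlux.faceFlux_coclosed`.
[cite: Balaban1984PropagatorsI, (1.21) p.21; Balaban1985BackgroundPropagators, (3.8) p.392; Balaban1987RG1, (0.3) p.252] -/
theorem block_outflow_eq_of_divB_eq_zero (h : P.sitesPerDir 0 = P.L ^ k * P.sitesPerDir k) (y : Site P k)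
    (T : (Fin P.d → Fin (P.L ^ k)) → 𝔸ˣ) (U : Fin P.d → Site P 0 → 𝔸ˣ) (B : Fin P.d → Site P 0 → 𝔸)
    (hB : ∀ r : Fin P.d → Fin (P.L ^ k), divB (torusT P 0) U B (Site.fibreSite 0 k y r) = 0) :
    ∑ μ : Fin P.d, ∑ r ∈ univ.filter (fun r : Fin P.d → Fin (P.L ^ k) => (r μ : ℕ) + 1 = P.L ^ k),
        R (T r) (B μ (Site.fibreSite 0 k y r))
      = ∑ μ : Fin P.d, ∑ r ∈ univ.filter (fun r : Fin P.d → Fin (P.L ^ k) => (r μ : ℕ) = 0),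
            R (T r * (U μ ((Site.fibreSite 0 k y r).unshift μ))⁻¹) (B μ ((Site.fibreSite 0 k y r).unshift μ))
        + ∑ μ : Fin P.d, ∑ r ∈ univ.filter (fun r : Fin P.d → Fin (P.L ^ k) => (r μ : ℕ) + 1 < P.L ^ k),
            R (T r) (R ((T r)⁻¹ * T (Function.update r μ ⟨min ((r μ : ℕ) + 1) (P.L ^ k - 1), by have := (r μ).isLt; omega⟩) * (U μ (Site.fibreSite 0 k y r))⁻¹)
              (B μ (Site.fibreSite 0 k y r)) - B μ (Site.fibreSite 0 k y r)) := by
  have hG := block_sum_R_divB_eq h y T U B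
  have h0 : ∑ r : Fin P.d → Fin (P.L ^ k), R (T r) (divB (torusT P 0) U B (Site.fibreSite 0 k y r)) = 0 :=
    Finset.sum_eq_zero fun r _ => by rw [hB r, B9Eq39Adjoint.R_zero]
  rw [h0, eq_sub_iff_add_eq, zero_add] at hG
  rw [hG, add_comm]

/-- ★ **THE NEAR FACE OF `B(y)` IS THE FAR FACE OF `B(y − e_μ)`**: the inflow term of ✓ `block_sum_R_divB_eq` re-indexed on the far layer `{r̄_μ + 1 = L^k}` of the receding block —
the inflowing bond into `x_{r̄ with r̄_μ ↦ 0} ∈ B(y)` is `(x′_{r̄}, μ)` with `x′_{r̄} = fibreSite 0 k (y − e_μ) r̄`, carried by `T` at the RECEIVING offset.  (This is where the (P)-inhabitant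
meets the coarse pairing ✓ `Prop7CovFaceFluxPairing.sum_re_trace_pureGauge_mul_eq`, whose second summand lives on the bonds `⟨y − e_μ, μ⟩`.)
[cite: Balaban1984PropagatorsI, (1.21) p.21; Balaban1987RG1, (0.3) p.252] -/
theorem block_inflow_eq_far_layer (h : P.sitesPerDir 0 = P.L ^ k * P.sitesPerDir k) (y : Site P k)
    (T : (Fin P.d → Fin (P.L ^ k)) → 𝔸ˣ) (U : Fin P.d → Site P 0 → 𝔸ˣ) (B : Fin P.d → Site P 0 → 𝔸) (μ : Fin P.d) :
    ∑ r ∈ univ.filter (fun r : Fin P.d → Fin (P.L ^ k) => (r μ : ℕ) = 0),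
        R (T r * (U μ ((Site.fibreSite 0 k y r).unshift μ))⁻¹) (B μ ((Site.fibreSite 0 k y r).unshift μ))
      = ∑ rbar ∈ univ.filter (fun r : Fin P.d → Fin (P.L ^ k) => (r μ : ℕ) + 1 = P.L ^ k),
          R (T (Function.update rbar μ ⟨0, pow_pos P.L_pos k⟩) * (U μ (Site.fibreSite 0 k (y.unshift μ) rbar))⁻¹)
            (B μ (Site.fibreSite 0 k (y.unshift μ) rbar)) := by
  have hℓ : 0 < P.L ^ k := pow_pos P.L_pos k
  refine Finset.sum_nbij' (fun r => Function.update r μ ⟨P.L ^ k - 1, Nat.sub_lt hℓ one_pos⟩) (fun rbar => Function.update rbar μ ⟨0, hℓ⟩)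
    ?_ ?_ ?_ ?_ ?_
  · intro r hr
    simp only [Finset.mem_filter, Finset.mem_univ, true_and] at hr ⊢
    simp only [Function.update_self, Fin.val_mk]
    omega
  · intro r hr
    simp only [Finset.mem_filter, Finset.mem_univ, true_and, Function.update_self, Fin.val_mk]
  · intro r hr
    simp only [Finset.mem_filter, Finset.mem_univ, true_and] at hr
    exact update_update_eq_self r μ _ _ (by simp only [hr])
  · intro r hr
    simp only [Finset.mem_filter, Finset.mem_univ, true_and] at hr
    exact update_update_eq_self r μ _ _ (by show P.L ^ k - 1 = (r μ : ℕ); omega)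
  · intro r hr
    simp only [Finset.mem_filter, Finset.mem_univ, true_and] at hr
    rw [fibreSite_unshift_of_zero h y r μ hr, update_update_eq_self r μ _ _ (by simp only [hr])]

end Gauss

/-! ## §3 Line-mates: every offset is (far-layer offset, position on its line) -/

section Lines

/-- ★ **LINE-MATES REGROUPING**: a sum over all offsets of the block is the sum over the far `μ`-layer `{r̄_μ + 1 = L^k}` of the sums along the `μ`-lines `s ↦ r̄ with r̄_μ ↦ s`
(✓ `Prop7CovRightInverse.filter_update_eq_image`; the `L^k` line-mates of a far-face point share it — the regrouping behind `FACE′_c = L^k • OUT_μ(y)` of the face functional).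
[cite: Balaban1985Variational, (45)-(46) p.285; Balaban1987RG1, (0.3) p.252] -/
theorem sum_eq_sum_far_layer_lines {M : Type*} [AddCommMonoid M] (μ : Fin P.d) (g : (Fin P.d → Fin (P.L ^ k)) → M) :
    ∑ r : Fin P.d → Fin (P.L ^ k), g r
      = ∑ rbar ∈ univ.filter (fun r : Fin P.d → Fin (P.L ^ k) => (r μ : ℕ) + 1 = P.L ^ k),
          ∑ s : Fin (P.L ^ k), g (Function.update rbar μ s) := by
  classical
  have hℓ : 0 < P.L ^ k := pow_pos P.L_pos k
  set last : Fin (P.L ^ k) := ⟨P.L ^ k - 1, Nat.sub_lt hℓ one_pos⟩ with hlast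
  have hfar : ∀ r : Fin P.d → Fin (P.L ^ k), ((r μ : ℕ) + 1 = P.L ^ k) ↔ r μ = last := fun r => by
    constructor
    · intro h1
      apply Fin.ext
      show (r μ : ℕ) = P.L ^ k - 1
      omega
    · intro h1
      rw [h1]
      show P.L ^ k - 1 + 1 = P.L ^ k
      omega
  rw [Finset.filter_congr (fun r _ => hfar r)]
  rw [← Finset.sum_fiberwise_of_maps_to (s := (univ : Finset (Fin P.d → Fin (P.L ^ k)))) (t := univ.filter fun r : Fin P.d → Fin (P.L ^ k) => r μ = last)
    (g := fun r => Function.update r μ last) (fun r _ => by simp)]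
  refine Finset.sum_congr rfl fun rbar hrbar => ?_
  have hr : rbar μ = last := (Finset.mem_filter.mp hrbar).2
  rw [Prop7CovRightInverse.filter_update_eq_image μ last rbar hr]
  rw [Finset.sum_image]
  intro s _ s' _ hss
  have := congrArg (fun r => r μ) hss
  simpa using this

end Lines

/-! ## §4 (v1.1) The coarse NET FLUX of a block: interior defect + the near-face JUNCTION -/

section NetFlux

variable {𝔸 : Type*} [Ring 𝔸]

/-- ★★ **THE COARSE NET FLUX OF A BLOCK = INTERIOR HOLONOMY DEFECT + NEAR-FACE JUNCTION** (exact; the kinematic core of the Gauss row `hX` after the coarse summation by parts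
✓ `Prop7CovFaceFluxPairing.sum_re_trace_pureGauge_mul_eq`).  Per-block offset transports `T_y : offsets → 𝔸ˣ` (any), coarse bond variables `V_μ(y′)` on `(y′, y′ + e_μ)` (any units),
background `U`, and a covariantly CO-CLOSED bond field `B` (`D*_UB = 0`).  With `OUT_μ(y) := Σ_{r̄_μ+1 = L^k} R(T_y r̄)B_μ(x^y_{r̄})` (the comb-direct face functional, `FACE′` of
✓ `Prop7CovFaceFluxFacePiece` up to `L^k•` and the frame) the net coarse flux at `y` is
`Σ_μ (OUT_μ(y) − R(V_μ(y−e_μ)⁻¹)·OUT_μ(y−e_μ)) = Σ_μ INT_μ(y) + Σ_μ Σ_{r̄ far} (R(T_y(r̄ with r̄_μ↦0)·U_μ(x^{y−e_μ}_{r̄})⁻¹) − R(V_μ(y−e_μ)⁻¹·T_{y−e_μ} r̄)) B_μ(x^{y−e_μ}_{r̄})`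
— the second sum is the JUNCTION `J_VH`: at each bond crossing the near face of `B(y)`, the receiving block's comb-then-bond transport versus the coarse variable composed with the
receding block's comb (px17 LOCATE §3 (G3)); it vanishes identically when `V_μ(y−e_μ) = T_y(r̄↦0)·U_μ(·)⁻¹·(T_{y−e_μ} r̄)⁻¹` bondwise, and is `e`-small for the averages of record.
[cite: Balaban1984PropagatorsI, (1.21) p.21; Balaban1985BackgroundPropagators, (3.5) p.391, (3.8) p.392; Balaban1985Averaging, (9) p.18; Balaban1987RG1, (0.3) p.252] -/
theorem block_netFlux_eq_int_add_junction (h : P.sitesPerDir 0 = P.L ^ k * P.sitesPerDir k)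
    (T : Site P k → (Fin P.d → Fin (P.L ^ k)) → 𝔸ˣ) (V : Fin P.d → Site P k → 𝔸ˣ) (U : Fin P.d → Site P 0 → 𝔸ˣ) (B : Fin P.d → Site P 0 → 𝔸)
    (hB : ∀ x : Site P 0, divB (torusT P 0) U B x = 0) (y : Site P k) :
    ∑ μ : Fin P.d, (∑ r ∈ univ.filter (fun r : Fin P.d → Fin (P.L ^ k) => (r μ : ℕ) + 1 = P.L ^ k), R (T y r) (B μ (Site.fibreSite 0 k y r))
        - R (V μ (y.unshift μ))⁻¹ (∑ r ∈ univ.filter (fun r : Fin P.d → Fin (P.L ^ k) => (r μ : ℕ) + 1 = P.L ^ k),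
            R (T (y.unshift μ) r) (B μ (Site.fibreSite 0 k (y.unshift μ) r))))
      = ∑ μ : Fin P.d, ∑ r ∈ univ.filter (fun r : Fin P.d → Fin (P.L ^ k) => (r μ : ℕ) + 1 < P.L ^ k),
            R (T y r) (R ((T y r)⁻¹ * T y (Function.update r μ ⟨min ((r μ : ℕ) + 1) (P.L ^ k - 1), by have := (r μ).isLt; omega⟩) * (U μ (Site.fibreSite 0 k y r))⁻¹)
              (B μ (Site.fibreSite 0 k y r)) - B μ (Site.fibreSite 0 k y r))
        + ∑ μ : Fin P.d, ∑ r ∈ univ.filter (fun r : Fin P.d → Fin (P.L ^ k) => (r μ : ℕ) + 1 = P.L ^ k),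
            (R (T y (Function.update r μ ⟨0, pow_pos P.L_pos k⟩) * (U μ (Site.fibreSite 0 k (y.unshift μ) r))⁻¹) (B μ (Site.fibreSite 0 k (y.unshift μ) r))
              - R ((V μ (y.unshift μ))⁻¹ * T (y.unshift μ) r) (B μ (Site.fibreSite 0 k (y.unshift μ) r))) := by
  -- Gauss for the block `B(y)` with the transports `T y`, inflow read on the receding blocks' far layers
  have hG := block_outflow_eq_of_divB_eq_zero h y (T y) U B (fun r => hB _)
  have hIN : ∀ μ : Fin P.d, ∑ r ∈ univ.filter (fun r : Fin P.d → Fin (P.L ^ k) => (r μ : ℕ) = 0),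
        R (T y r * (U μ ((Site.fibreSite 0 k y r).unshift μ))⁻¹) (B μ ((Site.fibreSite 0 k y r).unshift μ))
      = ∑ rbar ∈ univ.filter (fun r : Fin P.d → Fin (P.L ^ k) => (r μ : ℕ) + 1 = P.L ^ k),
          R (T y (Function.update rbar μ ⟨0, pow_pos P.L_pos k⟩) * (U μ (Site.fibreSite 0 k (y.unshift μ) rbar))⁻¹)
            (B μ (Site.fibreSite 0 k (y.unshift μ) rbar)) := fun μ => block_inflow_eq_far_layer h y (T y) U B μ
  rw [Finset.sum_congr rfl fun μ _ => hIN μ] at hG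
  -- `OUT − R(V⁻¹)OUT′ = (IN + INT) − R(V⁻¹)OUT′`, and `IN − R(V⁻¹)OUT′` is the junction, bond by bond
  rw [Finset.sum_sub_distrib, hG]
  simp only [Prop7CovCombGauss.R_finset_sum, ← B9Eq39Adjoint.R_mul, Finset.sum_sub_distrib]
  abel

end NetFlux

end Summit.QuantumFields.YangMills.Theorems.Prop7CovBlockGauss

end
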